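import Summits.CriticalPhenomena.PercolationContinuityZ3.Theorems.PercNearOneGluingNoHeavyLowerTailSunflowerParityLemma
import Mathlib.Combinatorics.Enumerative.InclusionExclusion
import HarnessLib

/-!
# `NoHeavyLowerTail` (crux stmt-CriticalPhenomena-4575), hull-port line hp-7: the SIGNED (integer) parity lemma —
# the Möbius-weighted interval matrix of an up-set is unimodular over `ℤ`

Support file (prover `prim-hp-7`, generation 50; `--supports stmt-CriticalPhenomena-4575`).  No definitions, no `sorry`, standard axioms.
Memo: `prim-hp-7/FROM-prim-hp-7-g50-IC-KLEITMAN.md` §0 (S5).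

prim-l12-p2's PARITY LEMMA (`HallGladkov.gam_del_sum`, file `…SunflowerParityLemma`): for an up-set `G` of the cube `W` and `T, T″ ∈ OUT(G)`,
`Σ_{S ∈ IN(G)} γ(T,S)·δ(S,T″) ≡ [T = T″] (mod 2)` with the interval counts `γ(T,S) = #{R ∈ [T,S] : W∖R ∈ G}`, `δ(S,T″) = #(G ∩ [T″,S])` — the engine of
the `GF(2)`-rank proofs of the Hall–Gladkov matching theorem (l12-p2) and of sunflower–Kleitman for acyclic orientations (hp-7, `JBern.card_filter_source_le_card_filter_target`).
THIS FILE lifts it to the integers: with MÖBIUS SIGNS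
  `γ̃(T,S) = Σ_{R ∈ [T,S], W∖R ∈ G} (−1)^{#(R∖T)}`,   `δ̃(S,T″) = Σ_{C ∈ G ∩ [T″,S]} (−1)^{#(C∖T″)}`,   weight `(−1)^{#(W∖S)}`,
one has the EXACT identity (`JBern.signed_gam_del_sum`)
  `Σ_{S ∈ IN(G)} (−1)^{#(W∖S)} γ̃(T,S) δ̃(S,T″) = (−1)^{#(W∖T)} [T = T″]`   for `T, T″ ∈ OUT(G)`,
so the square matrix `Δ̃ = [δ̃(S,T″)]_{S ∈ IN(G), T″ ∈ OUT(G)}` is invertible over `ℤ` (unimodular), not only over `GF(2)`.  Consequences (memo S5): the acyclic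
sunflower–Kleitman elimination runs in characteristic `0`; for hp-7's source × target matrices the signed Gram `Ã·diag((−1)^{|t|})·Ỹᵀ = E + N` holds exactly
(`E = ±I` on equal heads, `N` supported on `head(s) = tail(s″)`), the starting point of the 'P-mixed' rank route to the cyclic rows.
PROOF: as in the `GF(2)` case — the summand vanishes off `IN(G)` EXACTLY (`Σ_{R ∈ [T,S]} (−1)^{#(R∖T)} = [T = S]`), the `S`-sum is the signed superset count
`Σ_{S ⊇ Y} (−1)^{#(W∖S)} = [Y = W]`, then two more signed interval sums. [this work]
-/

namespace Summit.CriticalPhenomena.PercolationContinuityZ3.Theorems.JBern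

open Finset
open Summit.CriticalPhenomena.PercolationContinuityZ3.Theorems.SunflowerPartition.HallGladkov

variable {α : Type*} [DecidableEq α]

/-! ## Signed interval sums (Möbius function of the cube) -/

/-- **Signed interval sum**: for `S ⊆ W`, `Σ_{R ⊆ W, T ⊆ R ⊆ S} (−1)^{#(R∖T)} = [T = S]`. [folklore] -/
theorem sum_Icc_neg_one_pow {T S W : Finset α} (hSW : S ⊆ W) :
    (∑ R ∈ W.powerset, (if T ⊆ R ∧ R ⊆ S then (-1 : ℤ) ^ #(R \ T) else 0)) = if T = S then 1 else 0 := by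
  by_cases hTS : T ⊆ S
  · rw [← Finset.sum_filter]
    have key : (∑ R ∈ W.powerset.filter (fun R => T ⊆ R ∧ R ⊆ S), (-1 : ℤ) ^ #(R \ T))
        = ∑ m ∈ (S \ T).powerset, (-1 : ℤ) ^ #m := by
      refine Finset.sum_nbij' (fun R => R \ T) (fun m => m ∪ T) ?_ ?_ ?_ ?_ ?_
      · intro R hR
        rw [mem_filter] at hR
        exact mem_powerset.2 (sdiff_subset_sdiff hR.2.2 subset_rfl)
      · intro m hm
        rw [mem_powerset] at hm
        have hmS : m ⊆ S := hm.trans sdiff_subset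
        exact mem_filter.2 ⟨mem_powerset.2 ((union_subset hmS hTS).trans hSW), subset_union_right, union_subset hmS hTS⟩
      · intro R hR
        rw [mem_filter] at hR
        exact sdiff_union_of_subset hR.2.1
      · intro m hm
        rw [mem_powerset] at hm
        rw [union_sdiff_right]
        exact sdiff_eq_self_of_disjoint (disjoint_of_subset_left hm disjoint_sdiff_self_left)
      · intro R _; rfl
    rw [key, Finset.sum_powerset_neg_one_pow_card]
    by_cases h : T = S
    · subst h; simp
    · rw [if_neg h, if_neg]
      intro h0
      exact h (Subset.antisymm hTS (Finset.sdiff_eq_empty_iff_subset.1 h0))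
  · have hne : T ≠ S := fun h => hTS (h ▸ subset_rfl)
    rw [if_neg hne]
    refine sum_eq_zero fun R _ => ?_
    rw [if_neg]
    rintro ⟨h1, h2⟩
    exact hTS (h1.trans h2)

/-- **Signed superset count**: for `Y ⊆ W`, `Σ_{Y ⊆ S ⊆ W} (−1)^{#(W∖S)} = [Y = W]`. [folklore] -/
theorem sum_superset_neg_one_pow {Y W : Finset α} (hYW : Y ⊆ W) :
    (∑ S ∈ W.powerset, (if Y ⊆ S then (-1 : ℤ) ^ #(W \ S) else 0)) = if Y = W then 1 else 0 := by
  rw [← sum_powerset_compl W (fun S => if Y ⊆ S then (-1 : ℤ) ^ #(W \ S) else 0)]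
  have h1 : ∀ S ∈ W.powerset, (fun S => if Y ⊆ S then (-1 : ℤ) ^ #(W \ S) else 0) (W \ S)
      = if ∅ ⊆ S ∧ S ⊆ W \ Y then (-1 : ℤ) ^ #(S \ ∅) else 0 := by
    intro S hS
    have hSW : S ⊆ W := mem_powerset.1 hS
    simp only [Finset.sdiff_sdiff_eq_self hSW, sdiff_empty, empty_subset, true_and]
    by_cases h : Y ⊆ W \ S
    · rw [if_pos h, if_pos]
      intro x hx
      rw [mem_sdiff]
      refine ⟨hSW hx, fun hxY => ?_⟩
      exact (mem_sdiff.1 (h hxY)).2 hx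
    · rw [if_neg h, if_neg]
      intro h'
      apply h
      intro y hy
      rw [mem_sdiff]
      refine ⟨hYW hy, fun hyS => ?_⟩
      exact (mem_sdiff.1 (h' hyS)).2 hy
  rw [sum_congr rfl h1, sum_Icc_neg_one_pow sdiff_subset]
  by_cases h : Y = W
  · subst h; simp
  · rw [if_neg h, if_neg]
    intro h0
    exact h (Subset.antisymm hYW (Finset.sdiff_eq_empty_iff_subset.1 h0.symm))

/-! ## Vanishing off `IN(G)` -/

/-- Off `IN(G)`, inside `G ∩ τG`: `γ̃(T,S) = 0` exactly, for `T ∉ G`, `S ∈ G`, `W∖S ∈ G`. [this work] -/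
theorem signed_gam_eq_zero_of_mem_mem {G : Finset (Finset α)} (hG : IsUpperSet (G : Set (Finset α))) {W T S : Finset α}
    (hTG : T ∉ G) (hSW : S ⊆ W) (hSG : S ∈ G) (hScG : W \ S ∈ G) :
    (∑ R ∈ W.powerset, (if T ⊆ R ∧ R ⊆ S ∧ W \ R ∈ G then (-1 : ℤ) ^ #(R \ T) else 0)) = 0 := by
  have hTS : T ≠ S := fun h => hTG (h ▸ hSG)
  calc (∑ R ∈ W.powerset, (if T ⊆ R ∧ R ⊆ S ∧ W \ R ∈ G then (-1 : ℤ) ^ #(R \ T) else 0))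
      = ∑ R ∈ W.powerset, (if T ⊆ R ∧ R ⊆ S then (-1 : ℤ) ^ #(R \ T) else 0) := by
        refine sum_congr rfl fun R _ => ?_
        by_cases h : T ⊆ R ∧ R ⊆ S
        · rw [if_pos h, if_pos ⟨h.1, h.2, up_mem hG (Finset.sdiff_subset_sdiff subset_rfl h.2) hScG⟩]
        · rw [if_neg h, if_neg fun h' => h ⟨h'.1, h'.2.1⟩]
    _ = if T = S then 1 else 0 := sum_Icc_neg_one_pow hSW
    _ = 0 := if_neg hTS

/-- Off `IN(G)`, outside `G`: `δ̃(S,T″) = 0` for `S ∉ G`. [this work] -/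
theorem signed_del_eq_zero_of_not_mem {G : Finset (Finset α)} (hG : IsUpperSet (G : Set (Finset α))) {W T'' S : Finset α}
    (hSG : S ∉ G) :
    (∑ C ∈ W.powerset, (if C ∈ G ∧ T'' ⊆ C ∧ C ⊆ S then (-1 : ℤ) ^ #(C \ T'') else 0)) = 0 := by
  refine sum_eq_zero fun C _ => ?_
  rw [if_neg]
  rintro ⟨hCG, -, hCS⟩
  exact hSG (up_mem hG hCS hCG)

/-! ## Sign bookkeeping -/

/-- For `A ⊆ B ⊆ C`: `(−1)^{#(C∖A)} = (−1)^{#(C∖B)} (−1)^{#(B∖A)}`. [folklore] -/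
theorem neg_one_pow_card_sdiff_trans {A B C : Finset α} (hAB : A ⊆ B) (hBC : B ⊆ C) :
    (-1 : ℤ) ^ #(C \ A) = (-1 : ℤ) ^ #(C \ B) * (-1 : ℤ) ^ #(B \ A) := by
  have hunion : C \ A = (C \ B) ∪ (B \ A) := by
    ext x
    simp only [mem_sdiff, mem_union]
    constructor
    · rintro ⟨hxC, hxA⟩
      by_cases hxB : x ∈ B
      · exact Or.inr ⟨hxB, hxA⟩
      · exact Or.inl ⟨hxC, hxB⟩
    · rintro (⟨hxC, hxB⟩ | ⟨hxB, hxA⟩)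
      · exact ⟨hxC, fun hxA => hxB (hAB hxA)⟩
      · exact ⟨hBC hxB, hxA⟩
  have hdisj : Disjoint (C \ B) (B \ A) := by
    rw [Finset.disjoint_left]
    intro x hx hx'
    exact (mem_sdiff.1 hx).2 (mem_sdiff.1 hx').1
  rw [hunion, card_union_of_disjoint hdisj, pow_add]

/-! ## The signed parity lemma -/

/-- **SIGNED PARITY LEMMA** (this work).  For an up-set `G` of the cube `W` and `T, T″ ∈ OUT(G)`:
`Σ_{S ∈ IN(G)} (−1)^{#(W∖S)} γ̃(T,S) δ̃(S,T″) = (−1)^{#(W∖T)} [T = T″]` over `ℤ`, with the Möbius-signed interval counts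
`γ̃(T,S) = Σ_{R ∈ [T,S], W∖R ∈ G} (−1)^{#(R∖T)}`, `δ̃(S,T″) = Σ_{C ∈ G ∩ [T″,S]} (−1)^{#(C∖T″)}`.  Hence the matrix `[δ̃(S,T″)]_{S ∈ IN(G), T″ ∈ OUT(G)}`
has an integer left inverse: it is unimodular.  Reducing mod 2 recovers `HallGladkov.gam_del_sum`. [this work] -/
theorem signed_gam_del_sum {G : Finset (Finset α)} (hG : IsUpperSet (G : Set (Finset α))) (W : Finset α)
    {T T'' : Finset α} (hT : T ∈ outV G W) (hT'' : T'' ∈ outV G W) :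
    (∑ S ∈ inV G W, (-1 : ℤ) ^ #(W \ S) *
        ((∑ R ∈ W.powerset, (if T ⊆ R ∧ R ⊆ S ∧ W \ R ∈ G then (-1 : ℤ) ^ #(R \ T) else 0)) *
         (∑ C ∈ W.powerset, (if C ∈ G ∧ T'' ⊆ C ∧ C ⊆ S then (-1 : ℤ) ^ #(C \ T'') else 0))))
      = if T = T'' then (-1 : ℤ) ^ #(W \ T) else 0 := by
  unfold outV at hT hT''
  rw [mem_filter, mem_powerset] at hT hT''
  obtain ⟨hTW, hTG, -⟩ := hT
  obtain ⟨hT2W, -, hT2cG⟩ := hT''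
  -- (a) the summand vanishes off `IN(G)`: sum over the whole cube
  have hsub : inV G W ⊆ W.powerset := fun S hS => by unfold inV at hS; exact (mem_filter.1 hS).1
  rw [Finset.sum_subset hsub ?vanish]
  case vanish =>
    intro S hS hSn
    have hSW : S ⊆ W := mem_powerset.1 hS
    have hSn' : ¬ (S ∈ G ∧ W \ S ∉ G) := fun h => hSn (by unfold inV; exact mem_filter.2 ⟨hS, h⟩)
    by_cases hSG : S ∈ G
    · have hScG : W \ S ∈ G := by by_contra h; exact hSn' ⟨hSG, h⟩
      rw [signed_gam_eq_zero_of_mem_mem hG hTG hSW hSG hScG, zero_mul, mul_zero]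
    · rw [signed_del_eq_zero_of_not_mem hG hSG, mul_zero, mul_zero]
  -- (b) expand the product and exchange the order of summation; the `S`-sum is the signed superset count of `R ∪ C`
  have hb : ∀ R ∈ W.powerset, ∀ C ∈ W.powerset,
      (∑ S ∈ W.powerset, (-1 : ℤ) ^ #(W \ S) * ((if T ⊆ R ∧ R ⊆ S ∧ W \ R ∈ G then (-1 : ℤ) ^ #(R \ T) else 0) *
         (if C ∈ G ∧ T'' ⊆ C ∧ C ⊆ S then (-1 : ℤ) ^ #(C \ T'') else 0)))
        = (if T ⊆ R ∧ W \ R ∈ G ∧ C ∈ G ∧ T'' ⊆ C then (-1 : ℤ) ^ #(R \ T) * (-1 : ℤ) ^ #(C \ T'') else 0) *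
          (if R ∪ C = W then 1 else 0) := by
    intro R hR C hC
    have hRW : R ⊆ W := mem_powerset.1 hR
    have hCW : C ⊆ W := mem_powerset.1 hC
    rw [← sum_superset_neg_one_pow (union_subset hRW hCW), Finset.mul_sum]
    refine sum_congr rfl fun S _ => ?_
    by_cases h1 : T ⊆ R ∧ W \ R ∈ G ∧ C ∈ G ∧ T'' ⊆ C
    · by_cases h2 : R ∪ C ⊆ S
      · rw [if_pos ⟨h1.1, subset_union_left.trans h2, h1.2.1⟩, if_pos ⟨h1.2.2.1, h1.2.2.2, subset_union_right.trans h2⟩,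
          if_pos h1, if_pos h2]
        ring
      · rw [if_pos h1, if_neg h2, mul_zero]
        by_cases hRS : R ⊆ S
        · rw [if_neg (fun h : C ∈ G ∧ T'' ⊆ C ∧ C ⊆ S => h2 (union_subset hRS h.2.2)), mul_zero, mul_zero]
        · rw [if_neg (fun h : T ⊆ R ∧ R ⊆ S ∧ W \ R ∈ G => hRS h.2.1), zero_mul, mul_zero]
    · rw [if_neg h1, zero_mul]
      by_cases hA : T ⊆ R ∧ R ⊆ S ∧ W \ R ∈ G
      · rw [if_neg (fun h : C ∈ G ∧ T'' ⊆ C ∧ C ⊆ S => h1 ⟨hA.1, hA.2.2, h.1, h.2.1⟩), mul_zero, mul_zero]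
      · rw [if_neg hA, zero_mul, mul_zero]
  rw [show (∑ S ∈ W.powerset, (-1 : ℤ) ^ #(W \ S) *
        ((∑ R ∈ W.powerset, (if T ⊆ R ∧ R ⊆ S ∧ W \ R ∈ G then (-1 : ℤ) ^ #(R \ T) else 0)) *
         (∑ C ∈ W.powerset, (if C ∈ G ∧ T'' ⊆ C ∧ C ⊆ S then (-1 : ℤ) ^ #(C \ T'') else 0))))
      = ∑ R ∈ W.powerset, ∑ C ∈ W.powerset,
          ((if T ⊆ R ∧ W \ R ∈ G ∧ C ∈ G ∧ T'' ⊆ C then (-1 : ℤ) ^ #(R \ T) * (-1 : ℤ) ^ #(C \ T'') else 0) *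
           (if R ∪ C = W then 1 else 0)) by
    rw [show (∑ S ∈ W.powerset, (-1 : ℤ) ^ #(W \ S) *
        ((∑ R ∈ W.powerset, (if T ⊆ R ∧ R ⊆ S ∧ W \ R ∈ G then (-1 : ℤ) ^ #(R \ T) else 0)) *
         (∑ C ∈ W.powerset, (if C ∈ G ∧ T'' ⊆ C ∧ C ⊆ S then (-1 : ℤ) ^ #(C \ T'') else 0))))
      = ∑ S ∈ W.powerset, ∑ R ∈ W.powerset, ∑ C ∈ W.powerset,
          ((-1 : ℤ) ^ #(W \ S) * ((if T ⊆ R ∧ R ⊆ S ∧ W \ R ∈ G then (-1 : ℤ) ^ #(R \ T) else 0) *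
           (if C ∈ G ∧ T'' ⊆ C ∧ C ⊆ S then (-1 : ℤ) ^ #(C \ T'') else 0))) from
      sum_congr rfl fun S _ => by rw [Finset.sum_mul_sum, Finset.mul_sum]; exact sum_congr rfl fun R _ => Finset.mul_sum _ _ _]
    rw [Finset.sum_comm]
    refine sum_congr rfl fun R hR => ?_
    rw [Finset.sum_comm]
    exact sum_congr rfl fun C hC => hb R hR C hC]
  -- (c) the `C`-sum: for `W ∖ R ∈ G` it is the signed superset count of `T″ ∪ (W ∖ R)`, i.e. `± [R ⊆ T″]`
  have hc : ∀ R ∈ W.powerset,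
      (∑ C ∈ W.powerset, ((if T ⊆ R ∧ W \ R ∈ G ∧ C ∈ G ∧ T'' ⊆ C then (-1 : ℤ) ^ #(R \ T) * (-1 : ℤ) ^ #(C \ T'') else 0) *
          (if R ∪ C = W then 1 else 0)))
        = if T ⊆ R ∧ R ⊆ T'' then (-1 : ℤ) ^ #(R \ T) * (-1 : ℤ) ^ #(W \ T'') else 0 := by
    intro R hR
    have hRW : R ⊆ W := mem_powerset.1 hR
    by_cases h1 : T ⊆ R ∧ W \ R ∈ G
    · -- rewrite the sum as `(-1)^{#(R∖T)} (-1)^{#(Y∖T″)} Σ_{Y ⊆ C ⊆ W} (-1)^{#(C∖Y)}`, `Y = T″ ∪ (W∖R)`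
      have hYW : T'' ∪ (W \ R) ⊆ W := union_subset hT2W sdiff_subset
      have hY : ∀ C ∈ W.powerset,
          ((if T ⊆ R ∧ W \ R ∈ G ∧ C ∈ G ∧ T'' ⊆ C then (-1 : ℤ) ^ #(R \ T) * (-1 : ℤ) ^ #(C \ T'') else 0) *
            (if R ∪ C = W then 1 else 0))
          = (-1 : ℤ) ^ #(R \ T) * (-1 : ℤ) ^ #((T'' ∪ (W \ R)) \ T'') *
            (if T'' ∪ (W \ R) ⊆ C ∧ C ⊆ W then (-1 : ℤ) ^ #(C \ (T'' ∪ (W \ R))) else 0) := by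
        intro C hC
        have hCW : C ⊆ W := mem_powerset.1 hC
        by_cases h : T'' ∪ (W \ R) ⊆ C
        · have hRC : W \ R ⊆ C := subset_union_right.trans h
          have hT2C : T'' ⊆ C := subset_union_left.trans h
          rw [if_pos ⟨h1.1, h1.2, up_mem hG hRC h1.2, hT2C⟩, if_pos ((union_eq_iff_sdiff_subset hRW hCW).2 hRC),
            if_pos ⟨h, hCW⟩, mul_one, neg_one_pow_card_sdiff_trans subset_union_left h]
          ring
        · rw [if_neg (fun h' : T'' ∪ (W \ R) ⊆ C ∧ C ⊆ W => h h'.1), mul_zero]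
          by_cases h3 : T ⊆ R ∧ W \ R ∈ G ∧ C ∈ G ∧ T'' ⊆ C
          · have hne : ¬ R ∪ C = W := fun hRCW =>
              h (union_subset h3.2.2.2 ((union_eq_iff_sdiff_subset hRW hCW).1 hRCW))
            rw [if_pos h3, if_neg hne, mul_zero]
          · rw [if_neg h3, zero_mul]
      rw [sum_congr rfl hY, ← Finset.mul_sum, sum_Icc_neg_one_pow (subset_refl W)]
      by_cases h : R ⊆ T''
      · have hYeq : T'' ∪ (W \ R) = W := (union_sdiff_eq_iff_subset hRW hT2W).2 h
        rw [if_pos hYeq, if_pos ⟨h1.1, h⟩, mul_one, hYeq]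
      · rw [if_neg (fun h' => h ((union_sdiff_eq_iff_subset hRW hT2W).1 h')), if_neg (fun h' => h h'.2), mul_zero]
    · rw [if_neg fun h => h1 ⟨h.1, up_mem hG (Finset.sdiff_subset_sdiff subset_rfl h.2) hT2cG⟩]
      refine sum_eq_zero fun C _ => ?_
      rw [if_neg fun h => h1 ⟨h.1, h.2.1⟩, zero_mul]
  rw [sum_congr rfl hc]
  -- (d) the `R`-sum is a signed interval count
  have hd : ∀ R ∈ W.powerset, (if T ⊆ R ∧ R ⊆ T'' then (-1 : ℤ) ^ #(R \ T) * (-1 : ℤ) ^ #(W \ T'') else 0)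
      = (if T ⊆ R ∧ R ⊆ T'' then (-1 : ℤ) ^ #(R \ T) else 0) * (-1 : ℤ) ^ #(W \ T'') := by
    intro R _
    split_ifs <;> simp
  rw [sum_congr rfl hd, ← Finset.sum_mul, sum_Icc_neg_one_pow hT2W]
  by_cases h : T = T''
  · subst h; simp
  · rw [if_neg h, if_neg h, zero_mul]

end Summit.CriticalPhenomena.PercolationContinuityZ3.Theorems.JBern
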